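import Mathlib
import HarnessLib
import Summits.NavierStokesRegularity.NavierStokesRegularity.Theses.LoopPeriodRatchet
import Summits.NavierStokesRegularity.NavierStokesRegularity.Theorems.LoopPeriodRatchetNoLoopsOfGrowth
import Summits.NavierStokesRegularity.NavierStokesRegularity.Theorems.LoopPeriodRatchetPeriodScalingBound

/-!
# `noloops_wall` — the wall under LINE 13 `hot_loops` (and LINES 11/12) typed EXACTLY (ns-idea-8 g6; kernel memo, not a line)

No summit is proved here; items 19708 / 20428 / 27893 / 22881 stay OPEN.  This file has NO `sorry`: it records, in the
kernel, that the shared wall S6G = item 27893 `LoopPeriodRatchet.FrequencyGrowthExponent` (the backward period-growth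
exponent `κ < 3/2` for closed vortex lines) is EQUIVALENT — given the tree's PROVED `periodScalingBound_proof` and
`noLoopsOfGrowth_proof` — to the bare statement «NoLoops»: an e₃-poloidal class Type-I ancient mild profile carries NO
closed vortex line with vorticity at any time.  The direction NoLoops ⇒ 27893 is vacuous (27893 only speaks about
non-stationary periodic orbits, which NoLoops forbids: `A := 1`, `κ := 0`); the direction 27893 ⇒ NoLoops is the tree's
engine.  Consequence for staffing (critic idea-crit-7 g4, P13-6 (i): «27893 carries the THICK column for three consumers with
no line of attack»): the growth-exponent PACKAGING of 27893 carries no slack — any attack on 27893 is an attack on NoLoops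
itself, and conversely any Liouville-type input that kills closed vortex lines of class poloidal profiles closes 27893, hence
(with S0 and HL3′) 19708 / 20428 via `Lines/hot_loops.lean` v4.3 and `Theorems/…HotLoopsReduction`, and feeds 22881 via
`Theorems/…HotLoopsPeakless.zero_of_strictPlanarExtremum`.  Known sub-stratum of NoLoops: axisymmetric no-swirl profiles
(every vortex line is a closed circle; NoLoops = ω_θ ≡ 0 = the KNSS 2009 no-swirl Liouville theorem via η = ω_θ/r,
[KochNadirashviliSereginSverak2009, Thm 5.2; corpus:book:seregin2014-lecture-notes-regularity-theory-navier-stokes-equations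
pp.117–121]); the general poloidal class has no weight playing the role of 1/r (no Killing field), which is the barrier.
-/

open scoped InnerProductSpace RealInnerProductSpace

namespace Summit.NavierStokesRegularity.NavierStokesRegularity.Cruxes.PoloidalWindowRigidity.NoLoopsWall

open Summit.NavierStokesRegularity.NavierStokesRegularity.Theses.LoopPeriodRatchet
open Summit.NavierStokesRegularity.NavierStokesRegularity.Theorems

/-- NoLoops ⇒ 27893 (vacuously: `A := 1`, `κ := 0`; a non-stationary periodic vortex line contradicts NoLoops applied to the
re-parametrised orbit `θ ↦ c (θ + s₀)`). The hypothesis is VERBATIM the conclusion of `LoopPeriodRatchet.NoLoopsOfGrowth`. -/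
theorem frequencyGrowthExponent_of_noLoops
    (h : (∀ (C : ℝ) (v : ℝ → EuclideanSpace ℝ (Fin 3) → EuclideanSpace ℝ (Fin 3)), Literature.Analysis.FluidPDE.HasTypeITimeDecay C v → ContinuousOn (Function.uncurry v) (Set.Iio (0 : ℝ) ×ˢ Set.univ) → (∀ s t : ℝ, s < t → t < 0 → ∀ x, v t x = Literature.Analysis.UnboundedOperators.heatExtension (v s) (t - s) x - Literature.Analysis.FluidPDE.oseenDuhamel 1 s v v t x) → (∀ t < 0, Literature.Analysis.FluidPDE.VectorCalculus.IsDivFree (v t)) → (∀ s < 0, ∀ y, ⟪Literature.Analysis.FluidPDE.curl (v s) y, EuclideanSpace.single 2 1⟫_ℝ = 0) → ∀ s : ℝ, s < 0 → ∀ (γ : ℝ → EuclideanSpace ℝ (Fin 3)) (ℓ : ℝ), 0 < ℓ → (∀ θ, HasDerivAt γ (Literature.Analysis.FluidPDE.curl (v s) (γ θ)) θ) → (∀ θ, γ (θ + ℓ) = γ θ) → Literature.Analysis.FluidPDE.curl (v s) (γ 0) = 0)) :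
    FrequencyGrowthExponent := by
  intro C v hd hc hm hdf hpol
  refine ⟨1, 0, one_pos, by norm_num, ?_⟩
  intro t₀ t _ht₀ ht c T hT hper hder hne
  obtain ⟨s₀, hs₀⟩ := hne
  exfalso
  apply hs₀
  have key := h C v hd hc hm hdf hpol t ht (fun θ => c (θ + s₀)) T hT
    (fun θ => (hder (θ + s₀)).comp_add_const θ s₀)
    (fun θ => by
      show c (θ + T + s₀) = c (θ + s₀)
      rw [add_right_comm]
      exact hper (θ + s₀))
  simpa using key

/-- 27893 ⇒ NoLoops: the tree's engine `noLoopsOfGrowth_proof` fed with the PROVED `periodScalingBound_proof`. -/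
theorem noLoops_of_frequencyGrowthExponent (hG : FrequencyGrowthExponent) :
    (∀ (C : ℝ) (v : ℝ → EuclideanSpace ℝ (Fin 3) → EuclideanSpace ℝ (Fin 3)), Literature.Analysis.FluidPDE.HasTypeITimeDecay C v → ContinuousOn (Function.uncurry v) (Set.Iio (0 : ℝ) ×ˢ Set.univ) → (∀ s t : ℝ, s < t → t < 0 → ∀ x, v t x = Literature.Analysis.UnboundedOperators.heatExtension (v s) (t - s) x - Literature.Analysis.FluidPDE.oseenDuhamel 1 s v v t x) → (∀ t < 0, Literature.Analysis.FluidPDE.VectorCalculus.IsDivFree (v t)) → (∀ s < 0, ∀ y, ⟪Literature.Analysis.FluidPDE.curl (v s) y, EuclideanSpace.single 2 1⟫_ℝ = 0) → ∀ s : ℝ, s < 0 → ∀ (γ : ℝ → EuclideanSpace ℝ (Fin 3)) (ℓ : ℝ), 0 < ℓ → (∀ θ, HasDerivAt γ (Literature.Analysis.FluidPDE.curl (v s) (γ θ)) θ) → (∀ θ, γ (θ + ℓ) = γ θ) → Literature.Analysis.FluidPDE.curl (v s) (γ 0) = 0) :=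
  LoopPeriodRatchetNoLoopsOfGrowth.noLoopsOfGrowth_proof hG LoopPeriodRatchetPeriodScalingBound.periodScalingBound_proof

/-- THE WALL, typed exactly: item 27893 `FrequencyGrowthExponent` ⟺ NoLoops (kernel-checked, no sorry). -/
theorem frequencyGrowthExponent_iff_noLoops :
    FrequencyGrowthExponent ↔ (∀ (C : ℝ) (v : ℝ → EuclideanSpace ℝ (Fin 3) → EuclideanSpace ℝ (Fin 3)), Literature.Analysis.FluidPDE.HasTypeITimeDecay C v → ContinuousOn (Function.uncurry v) (Set.Iio (0 : ℝ) ×ˢ Set.univ) → (∀ s t : ℝ, s < t → t < 0 → ∀ x, v t x = Literature.Analysis.UnboundedOperators.heatExtension (v s) (t - s) x - Literature.Analysis.FluidPDE.oseenDuhamel 1 s v v t x) → (∀ t < 0, Literature.Analysis.FluidPDE.VectorCalculus.IsDivFree (v t)) → (∀ s < 0, ∀ y, ⟪Literature.Analysis.FluidPDE.curl (v s) y, EuclideanSpace.single 2 1⟫_ℝ = 0) → ∀ s : ℝ, s < 0 → ∀ (γ : ℝ → EuclideanSpace ℝ (Fin 3)) (ℓ : ℝ), 0 < ℓ → (∀ θ,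 HasDerivAt γ (Literature.Analysis.FluidPDE.curl (v s) (γ θ)) θ) → (∀ θ, γ (θ + ℓ) = γ θ) → Literature.Analysis.FluidPDE.curl (v s) (γ 0) = 0) :=
  ⟨noLoops_of_frequencyGrowthExponent, frequencyGrowthExponent_of_noLoops⟩

end Summit.NavierStokesRegularity.NavierStokesRegularity.Cruxes.PoloidalWindowRigidity.NoLoopsWall
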